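import Literature.NumberTheory.EllipticCurves.RankinSymmSquareTwistComparison
import Literature.NumberTheory.EllipticCurves.NewformPeterssonSizeRankinSelbergProofs
import Literature.NumberTheory.EllipticCurves.ModularCurveSturmProofs
import Summits.BirchSwinnertonDyer.Rank1Residual.Additive.GordTwistDegreeIdentity
import HarnessLib

/-!
# X3/X4 at an additive prime: THE TWIST IDENTITY FOR THE MODULAR DEGREE ON THE `I₀*` CELL —
# `deg(D_W) · u² · c(D_V)² = (p − 1)((p + 1)² − a_p(V)²) · deg(D_V) · c(D_W)²` for `W = V ⊗ χ_{p*}`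
# with `V` GOOD at `p` (Watkins 2002 §2.1: `V_p = (p−1)(p+1−a_p)(p+1+a_p)`; Zagier 1985)

HONEST FRAMING (cell `b2b-bsdres`, run/shared/lean/b2b/bsd-rank1-residual/, verbatim in every
file): the goal of the cell is to DELETE the COMBINATION-SHAPED residual classes of the
Birch–Swinnerton-Dyer formula for ALL analytic-rank `≤ 1` elliptic curves over `ℚ` — "full BSD
formula for every rank `≤ 1` curve in class `C`" assembled STRICTLY from published theorems — so
that the rank-`≤ 1` remainder becomes exactly the CONSTRUCTION-SHAPED classes, which are TYPED
(missing-input `Prop`s), NOT attempted. This is not "finishing BSD". Sub-cell `additive-p2`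
(CLASS-OWNERS row "X3/X4 additive — pot. good ordinary / X3♯(G-ord)"), generation 17: research
route; no claim beyond the stated classes; theorems only, no definition, no named fact (tree
THEOREMS only: Zagier's degree formula `zagier_degree_formula_holds`, Rankin's residue
`tendsto_sub_two_mul_tsum_normSq_cuspCoeff_div_rpow`, the Euler-product comparison
`tendsto_normSq_mul_prod_eq`/`IsNewform0.locSq_eq_of_not_dvd`, `LFunction_quadraticTwist_pStar_apply`);
X3♯(G-ord)/X4♯(G-ord) stay CONSTRUCTION-SHAPED; no label moves; nothing is booked.

WHAT THIS FILE DOES. `GordTwistDegreeIdentity.lean` (this seat) and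
`Literature/…/ModularDegreeQuadraticTwistProofs.lean` (harvest-2) prove Watkins' `V_p = p` for a
twist pair in which BOTH curves are additive at `p` (defects 3, 4, 6: II ↔ IV*, III ↔ III*,
IV ↔ II*). The LARGEST part of the (G)-ordinary cell is the defect-`2` part — Kodaira `I₀*` —
whose `p*`-twist `V = W ⊗ χ_{p*}` is GOOD (ordinary) at `p`, of conductor `N/p²`: there the two
newforms live at DIFFERENT levels and differ at the multiples of `p` (`a_p(V) ≠ 0 = a_p(W)`), and the
printed law is Watkins, Experiment. Math. 11 (2002) §2.1 p. 491: "`V_p = (p−1)(p+1−l_p)(p+1+l_p)`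
… this appears already in [Zagier 1985]" (`l_p = a_p` of the `p`-minimal twist). This file PROVES
it from tree theorems:
* §1 `one_le_locSq`, `locSq_eq_one_of_cuspCoeff_pow_eq_zero`, **`petersson_ratio_of_coeff_twist_good`**
  — for newforms `f ∈ S₂(Γ₀(N))`, `g ∈ S₂(Γ₀(M))` with `p ∣ N`, `p ∤ M`, `|aₙ(f)| = |aₙ(g)|` for
  `p ∤ n` and `a_{p^e}(f) = 0` (`e ≥ 1`):
  **`Re(f,f) · (p+1)p² · ψ(M) = Re(g,g) · (p−1)((p+1)² − |a_p(g)|²) · ψ(N)`** (`ψ = [SL₂(ℤ):Γ₀(·)]`).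
  Proof: the tree's Euler-product comparison at real `w > 2`
  (`tsum_normSq_mul_prod_eq`: `D_f(w)·∏_{q∣NM} E_q(g,w) = D_g(w)·∏_{q∣NM} E_q(f,w)`), the local
  factors at `q ≠ p` cancel, `E_p(f, w) = 1`, and `E_p(g, w)` is the closed form
  `(1 + p·p^{−w})/((1 − p·p^{−w})(1 − (a² − 2p)p^{−w} + p²p^{−2w}))` (`IsNewform0.locSq_eq_of_not_dvd`),
  continuous at `w = 2` with value `(p+1)p²/((p−1)((p+1)² − a²))` (Hasse `a² ≤ 4p < (p+1)²`);
  Rankin's residue `(w−2)D(w) → 48π Re(·,·)/ψ` (`tendsto_sub_two_mul_tsum_normSq_cuspCoeff_div_rpow`).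
* §2 **`twist_modularDegree_identity_good`** — for `C • V^{(p*)} = W` over `ℚ` (`p` odd), `W`
  ADDITIVE at `p`, parametrisation data `D : MPD V M`, `D' : MPD W N` with `N = p²·M`, `p ∤ M`:
  **`deg(D')·u(C)²·c(D)² = (p − 1)·((p + 1)² − a_p(V)²)·deg(D)·c(D')²`** (`a_p(V) = V.LFunction p`;
  Zagier for both data; `p·covol(Λ_W) = u²·covol(Λ_V)` by `covolume_neronLattice_of_twist`;
  `ψ(p²M) = p(p+1)ψ(M)`). No optimality, no minimality, no named fact. The `p`-adic reading (the
  MANIN binder on X4♯(G-ord) ∩ I₀* at `p ∈ {5, 7}` from the good twist's degree) is in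
  `GordManinConstantTwistDegreeIstar.lean`.
Census (`HOME/b2b-bsdres-additive-p2/census/gen17b/`): with `c = c' = 1` and `u = ±1` the law
`deg(E) = (p−1)((p+1)²−a_p²)·deg(E ⊗ χ_{p*})` holds on 39 124 / 39 202 I₀* (G-ord) optimal pairs at
`p = 5` (the 78 others have a NON-optimal good twist with `c ≠ 1`, e.g. `275b1 ↔ 11a3`, `c(11a3) = 5`,
ratio `25`), 24 396 / 24 458 at `7`, 30 002 / 30 851 at `p ≥ 11`. Nothing here changes a label.

References: M. Watkins, *Computing the modular degree of an elliptic curve*, Experiment. Math. 11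
(2002) §2.1 p. 491 [Watkins2002]; D. Zagier, *Modular parametrizations of elliptic curves*, Canad.
Math. Bull. 28 (1985) §1–2 [ZagierCMB1985]; C. Delaunay, JTNB 15 (2003) Thm 1 [Delaunay2003];
D. Bump, *Automorphic forms and representations* §3.9 (local factors of `L(s, π × π̃)`) [Bump1997];
J. H. Silverman, *AEC* V.1.1 (Hasse), X Ex. 10.16 [SilvermanAEC2009].
-/

noncomputable section

open scoped MatrixGroups ModularForm Real Topology NumberField
open Filter CongruenceSubgroup WeierstrassCurve IsDedekindDomain NumberField Rat.HeightOneSpectrum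
  Literature.NumberTheory.EllipticCurves Literature.NumberTheory.EllipticCurves.ModularForms
  Literature.NumberTheory.EllipticCurves.Rank1Residual

namespace Summit.BirchSwinnertonDyer.Rank1Residual.Additive

/-! ### §1 The Rankin–Selberg comparison across the levels `N/p²` and `N` -/

/-- **`E_q(f, w) ≥ 1`** for a newform and real `w > 2`: the local series `Σ_e |a_{q^e}|²(q^e)^{−w}` has
non-negative terms and its `e = 0` term is `|a₁|² = 1`. [cite: Bump1997, §3.9] -/
theorem one_le_locSq {N : ℕ} [NeZero N] {f : CuspForm (Gamma0 N) 2} (hf : IsNewform0 f) {w : ℝ}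
    (hw : 2 < w) {p : ℕ} (hp : p.Prime) : 1 ≤ locSq f w p := by
  have hsum : Summable fun e : ℕ ↦ ‖cuspCoeff f (p ^ e)‖ ^ 2 / ((p ^ e : ℕ) : ℝ) ^ w :=
    (summable_normSq_cuspCoeff_div_rpow f hw).comp_injective (Nat.pow_right_injective hp.two_le)
  have h := hsum.le_tsum 0 fun e _ ↦ by positivity
  have h1 : cuspCoeff f 1 = 1 := hf.2.2
  simpa [locSq, h1] using h

/-- **`E_p(f, w) = 1`** when `a_{p^e}(f) = 0` for all `e ≥ 1` (an additive prime: the Euler factor is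
trivial). [cite: Bump1997, §3.9] -/
theorem locSq_eq_one_of_cuspCoeff_pow_eq_zero {N : ℕ} [NeZero N] {f : CuspForm (Gamma0 N) 2}
    (hf : IsNewform0 f) (w : ℝ) {p : ℕ} (_hp : p.Prime)
    (hzero : ∀ e : ℕ, 0 < e → cuspCoeff f (p ^ e) = 0) : locSq f w p = 1 := by
  have h1 : cuspCoeff f 1 = 1 := hf.2.2
  rw [locSq, tsum_eq_single 0 fun e he ↦ by rw [hzero e (Nat.pos_of_ne_zero he)]; simp]
  simp [h1]

/-- **THE PETERSSON NORMS OF `f ∈ S₂(Γ₀(N))` AND `g ∈ S₂(Γ₀(M))` WITH `|aₙ(f)| = |aₙ(g)|` OFF `p`,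
`a_{p^e}(f) = 0`, `p ∣ N`, `p ∤ M`:** `Re(f,f)·(p+1)p²·ψ(M) = Re(g,g)·(p−1)((p+1)² − |a_p(g)|²)·ψ(N)`.
Rankin–Selberg at both levels (`tendsto_sub_two_mul_tsum_normSq_cuspCoeff_div_rpow`), the Euler-product
comparison `tsum_normSq_mul_prod_eq` (local factors at `q ≠ p` cancel; `E_p(f,·) = 1`), and the closed
form of `E_p(g, w)` at a good prime (`IsNewform0.locSq_eq_of_not_dvd`), continuous at `w = 2` with value
`(p+1)p²/((p−1)((p+1)² − a²))` (`a² < (p+1)²` is the hypothesis `ha`, Hasse). This is Delaunay 2003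
Thm 1 / Watkins 2002 §2.1 in the case "`E_p` good at `p`". [cite: Watkins2002, §2.1 (p. 491)]
[cite: Delaunay2003, Thm 1] [cite: Bump1997, §3.9] -/
theorem petersson_ratio_of_coeff_twist_good {N M : ℕ} [NeZero N] [NeZero M]
    {f : CuspForm (Gamma0 N) 2} {g : CuspForm (Gamma0 M) 2} (hf : IsNewform0 f) (hg : IsNewform0 g)
    {p : ℕ} (hp : p.Prime) (hpN : p ∣ N) (hpM : ¬ p ∣ M)
    (hcoef : ∀ n : ℕ, ¬ p ∣ n → ‖cuspCoeff f n‖ = ‖cuspCoeff g n‖)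
    (hzero : ∀ e : ℕ, 0 < e → cuspCoeff f (p ^ e) = 0)
    (ha : ‖cuspCoeff g p‖ ^ 2 < ((p : ℝ) + 1) ^ 2) :
    (peterssonProduct (Gamma0 N) 2 f f).re * ((p + 1) * (p : ℝ) ^ 2) * gamma0Index M =
      (peterssonProduct (Gamma0 M) 2 g g).re * ((p - 1) * (((p : ℝ) + 1) ^ 2 - ‖cuspCoeff g p‖ ^ 2)) *
        gamma0Index N := by
  set a : ℝ := ‖cuspCoeff g p‖ with ha_def
  have hp1 : (1 : ℝ) < p := by exact_mod_cast hp.one_lt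
  have hp0 : (0 : ℝ) < p := by linarith
  have hNM : N * M ≠ 0 := mul_ne_zero (NeZero.ne N) (NeZero.ne M)
  have hpS : p ∈ (N * M).primeFactors :=
    Nat.mem_primeFactors.mpr ⟨hp, hpN.mul_right M, hNM⟩
  -- Step 1: for `w > 2`, `D_f(w) · E_p(g, w) = D_g(w)`
  have key : ∀ w : ℝ, 2 < w →
      (∑' n : ℕ, ‖cuspCoeff f n‖ ^ 2 / (n : ℝ) ^ w) * locSq g w p =
        ∑' n : ℕ, ‖cuspCoeff g n‖ ^ 2 / (n : ℝ) ^ w := by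
    intro w hw
    have h := tsum_normSq_mul_prod_eq hf hg (fun q hq hqNM ↦ hcoef q fun hpq ↦ ?_) hw
    swap
    · -- `p ∣ q`, `q` prime `⇒ q = p ∣ N M`
      have : q = p := ((Nat.prime_dvd_prime_iff_eq hp hq).mp hpq).symm
      exact hqNM (this ▸ hpN.mul_right M)
    rw [← Finset.mul_prod_erase _ _ hpS, ← Finset.mul_prod_erase _ _ hpS] at h
    have hprod : ∏ q ∈ (N * M).primeFactors.erase p, locSq f w q =
        ∏ q ∈ (N * M).primeFactors.erase p, locSq g w q := by
      refine Finset.prod_congr rfl fun q hq ↦ ?_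
      have hqp : q ≠ p := Finset.ne_of_mem_erase hq
      have hqprime : q.Prime := Nat.prime_of_mem_primeFactors (Finset.mem_of_mem_erase hq)
      unfold locSq
      refine tsum_congr fun e ↦ ?_
      rw [hcoef (q ^ e) fun hdvd ↦ hqp ((Nat.prime_dvd_prime_iff_eq hp hqprime).mp
        (hp.dvd_of_dvd_pow hdvd)).symm]
    have hone : locSq f w p = 1 := locSq_eq_one_of_cuspCoeff_pow_eq_zero hf w hp hzero
    have hPpos : 0 < ∏ q ∈ (N * M).primeFactors.erase p, locSq g w q :=
      Finset.prod_pos fun q hq ↦ lt_of_lt_of_le one_pos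
        (one_le_locSq hg hw (Nat.prime_of_mem_primeFactors (Finset.mem_of_mem_erase hq)))
    rw [hprod, hone, one_mul] at h
    -- `D_f · (L_p · P) = D_g · P`
    have h' : (∑' n : ℕ, ‖cuspCoeff f n‖ ^ 2 / (n : ℝ) ^ w) * locSq g w p *
        ∏ q ∈ (N * M).primeFactors.erase p, locSq g w q =
        (∑' n : ℕ, ‖cuspCoeff g n‖ ^ 2 / (n : ℝ) ^ w) *
          ∏ q ∈ (N * M).primeFactors.erase p, locSq g w q := by
      rw [mul_assoc]; exact h
    exact mul_right_cancel₀ hPpos.ne' h'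
  -- Step 2: the closed form of `E_p(g, w)` and its limit at `w = 2`
  set Φ : ℝ → ℝ := fun w ↦ (1 + p * (p : ℝ) ^ (-w)) /
      ((1 - p * (p : ℝ) ^ (-w)) * (1 - (a ^ 2 - 2 * p) * (p : ℝ) ^ (-w) +
        (p : ℝ) ^ 2 * ((p : ℝ) ^ (-w)) ^ 2)) with hΦ
  have hΦeq : ∀ w : ℝ, 2 < w → locSq g w p = Φ w := fun w hw ↦ hg.locSq_eq_of_not_dvd hw hp hpM
  have ht : Continuous fun w : ℝ ↦ (p : ℝ) ^ (-w) :=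
    (Real.continuous_const_rpow hp0.ne').comp continuous_neg
  have ht2 : (p : ℝ) ^ (-(2 : ℝ)) = ((p : ℝ) ^ 2)⁻¹ := by
    rw [Real.rpow_neg hp0.le, Real.rpow_two]
  have hden2 : (1 - p * (p : ℝ) ^ (-(2 : ℝ))) * (1 - (a ^ 2 - 2 * p) * (p : ℝ) ^ (-(2 : ℝ)) +
      (p : ℝ) ^ 2 * ((p : ℝ) ^ (-(2 : ℝ))) ^ 2) ≠ 0 := by
    rw [ht2]
    have h1 : (1 - p * ((p : ℝ) ^ 2)⁻¹) ≠ 0 := by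
      rw [sub_ne_zero, ne_comm, Ne, ← div_eq_mul_inv]
      rw [div_eq_one_iff_eq (by positivity)]
      nlinarith
    have h2 : 0 < (1 - (a ^ 2 - 2 * p) * ((p : ℝ) ^ 2)⁻¹ + (p : ℝ) ^ 2 * (((p : ℝ) ^ 2)⁻¹) ^ 2) := by
      have : (1 - (a ^ 2 - 2 * p) * ((p : ℝ) ^ 2)⁻¹ + (p : ℝ) ^ 2 * (((p : ℝ) ^ 2)⁻¹) ^ 2) =
          (((p : ℝ) + 1) ^ 2 - a ^ 2) / (p : ℝ) ^ 2 := by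
        field_simp
        ring
      rw [this]
      exact div_pos (by linarith) (by positivity)
    exact mul_ne_zero h1 h2.ne'
  have hΦcont : ContinuousAt Φ 2 := by
    simp only [hΦ]
    refine ContinuousAt.div ?_ ?_ hden2
    · exact (continuous_const.add (continuous_const.mul ht)).continuousAt
    · exact ((continuous_const.sub (continuous_const.mul ht)).mul
        ((continuous_const.sub (continuous_const.mul ht)).add
          (continuous_const.mul (ht.pow 2)))).continuousAt
  have hL : Tendsto (fun w : ℝ ↦ locSq g w p) (𝓝[>] 2) (𝓝 (Φ 2)) := by
    refine (hΦcont.tendsto.mono_left nhdsWithin_le_nhds).congr' ?_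
    filter_upwards [self_mem_nhdsWithin] with w hw
    exact (hΦeq w hw).symm
  -- Step 3: pass to the limit in `(w − 2) D_f(w) · E_p(g, w) = (w − 2) D_g(w)`
  have hF := tendsto_sub_two_mul_tsum_normSq_cuspCoeff_div_rpow f
  have hG := tendsto_sub_two_mul_tsum_normSq_cuspCoeff_div_rpow g
  have hFG : Tendsto (fun w : ℝ ↦ (w - 2) * ∑' n : ℕ, ‖cuspCoeff g n‖ ^ 2 / (n : ℝ) ^ w) (𝓝[>] 2)
      (𝓝 (48 * π * (peterssonProduct (Gamma0 N) 2 f f).re / gamma0Index N * Φ 2)) := by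
    refine (hF.mul hL).congr' ?_
    filter_upwards [self_mem_nhdsWithin] with w hw
    rw [mul_assoc, key w hw]
  have hlim := tendsto_nhds_unique hFG hG
  -- Step 4: algebra
  have hpm1 : (p : ℝ) - 1 ≠ 0 := by linarith
  have hq : ((p : ℝ) + 1) ^ 2 - a ^ 2 ≠ 0 := by linarith
  have e1 : (1 + p * ((p : ℝ) ^ 2)⁻¹) = (p + 1) / p := by field_simp
  have e2 : (1 - p * ((p : ℝ) ^ 2)⁻¹) = (p - 1) / p := by field_simp
  have e3 : (1 - (a ^ 2 - 2 * p) * ((p : ℝ) ^ 2)⁻¹ + (p : ℝ) ^ 2 * (((p : ℝ) ^ 2)⁻¹) ^ 2) =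
      (((p : ℝ) + 1) ^ 2 - a ^ 2) / (p : ℝ) ^ 2 := by field_simp; ring
  have hΦ2 : Φ 2 * ((p - 1) * (((p : ℝ) + 1) ^ 2 - a ^ 2)) = (p + 1) * (p : ℝ) ^ 2 := by
    simp only [hΦ, ht2, e1, e2, e3]
    field_simp
  have hψN : (0 : ℝ) < gamma0Index N := by exact_mod_cast gamma0Index_pos N
  have hψM : (0 : ℝ) < gamma0Index M := by exact_mod_cast gamma0Index_pos M
  have hπ : (0 : ℝ) < π := Real.pi_pos
  field_simp at hlim
  -- hlim : 48π Re(f,f) Φ(2) ψ(M) = 48π Re(g,g) ψ(N)  (up to arrangement)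
  have : (peterssonProduct (Gamma0 N) 2 f f).re * Φ 2 * gamma0Index M =
      (peterssonProduct (Gamma0 M) 2 g g).re * gamma0Index N := by
    nlinarith [hlim, hπ]
  calc (peterssonProduct (Gamma0 N) 2 f f).re * ((p + 1) * (p : ℝ) ^ 2) * gamma0Index M
      = (peterssonProduct (Gamma0 N) 2 f f).re * Φ 2 * gamma0Index M *
          ((p - 1) * (((p : ℝ) + 1) ^ 2 - a ^ 2)) := by rw [← hΦ2]; ring
    _ = (peterssonProduct (Gamma0 M) 2 g g).re * gamma0Index N *
          ((p - 1) * (((p : ℝ) + 1) ^ 2 - a ^ 2)) := by rw [this]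
    _ = _ := by ring


/-! ### §2 Watkins' `V_p = (p − 1)(p + 1 − a_p)(p + 1 + a_p)` -/

/-- **THE TWIST IDENTITY ON THE `I₀*` CELL.** Let `p` be an odd prime, `V, W` elliptic over `ℚ` with
`C • V^{(p*)} = W` and `W` ADDITIVE at `p` (so `a_{p^e}(W) = 0`), `D : MPD V M` and `D' : MPD W N`
parametrisation data with `N = p²·M` and `p ∤ M` (the conductor levels when `V` is good at `p`). Then
**`deg(D')·u(C)²·c(D)² = (p − 1)·((p + 1)² − a_p(V)²)·deg(D)·c(D')²`** with `a_p(V) = V.LFunction p`.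
Proof: §1 with `f = f_{D'}`, `g = f_D` (`|aₙ(W)| = |aₙ(V)|` for `p ∤ n` by `LFunction_quadraticTwist_pStar_apply`,
`(n/p) = ±1`; `a_{p^e}(W) = 0`; Hasse `a_p² ≤ 4p < (p+1)²`), `ψ(p²M) = p(p+1)ψ(M)`, Zagier's formula
for both data (`zagier_degree_formula_holds`) and `p·covol(Λ_W) = u²·covol(Λ_V)`
(`covolume_neronLattice_of_twist`). Watkins 2002 §2.1: "`V_p = (p−1)(p+1−l_p)(p+1+l_p)` … this
appears already in [Zagier 1985]". No optimality, no minimality, no named fact.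
[cite: Watkins2002, §2.1 (p. 491)] [cite: ZagierCMB1985, §1 (p. 374)] -/
theorem twist_modularDegree_identity_good (p : ℕ) [hp : Fact p.Prime] (hp2 : p ≠ 2)
    (V W : WeierstrassCurve ℚ) [V.IsElliptic] [W.IsElliptic] (hW : Addv W p) (C : VariableChange ℚ)
    (hC : C • V.quadraticTwist ((-1 : ℚ) ^ (p / 2) * p) = W) {M N : ℕ} [NeZero M] [NeZero N]
    (hN : N = p ^ 2 * M) (hpM : ¬ p ∣ M)
    (D : ModularParametrizationData V M) (D' : ModularParametrizationData W N) :
    (D'.modularDegree : ℝ) * ((C.u : ℚ) : ℝ) ^ 2 * (D.maninConstant : ℝ) ^ 2 =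
      ((p : ℝ) - 1) * (((p : ℝ) + 1) ^ 2 - ((V.LFunction p : ℤ) : ℝ) ^ 2) * D.modularDegree *
        (D'.maninConstant : ℝ) ^ 2 := by
  simp only [ModularParametrizationData.modularDegree, ModularParametrizationData.maninConstant]
  have hpp : p.Prime := hp.out
  have hd0 : ((-1 : ℚ) ^ (p / 2) * p) ≠ 0 :=
    mul_ne_zero (pow_ne_zero _ (by norm_num)) (by exact_mod_cast hpp.ne_zero)
  haveI : (V.quadraticTwist ((-1 : ℚ) ^ (p / 2) * p)).IsElliptic := V.isElliptic_quadraticTwist hd0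
  -- coefficients: away from `p` equal in absolute value; at powers of `p` the twist's vanish
  have hLW : W.LFunction = (V.quadraticTwist ((-1 : ℚ) ^ (p / 2) * p)).LFunction := by
    rw [← hC, LFunction_smul]
  have hcoef : ∀ n : ℕ, ¬ p ∣ n → ‖cuspCoeff D'.f n‖ = ‖cuspCoeff D.f n‖ := by
    intro n hn
    rw [D'.isNewformOf.2 n, D.isNewformOf.2 n, hLW]
    have h2 := V.LFunction_quadraticTwist_pStar_apply hp2 hn
    push_cast at h2
    rw [h2]
    have hn' : ((n : ℤ) : ZMod p) ≠ 0 := by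
      rw [Int.cast_natCast, Ne, ZMod.natCast_eq_zero_iff]
      exact hn
    push_cast
    rw [norm_mul]
    rcases legendreSym.eq_one_or_neg_one p hn' with h | h <;> simp [h]
  have hzero : ∀ e : ℕ, 0 < e → cuspCoeff D'.f (p ^ e) = 0 := by
    intro e he
    rw [D'.isNewformOf.2]
    have hv : (primesEquiv ((primesEquiv (R := 𝓞 ℚ)).symm ⟨p, hpp⟩) : ℕ) = p :=
      primesEquiv_symm_apply_coe p
    rw [W.LFunction_apply_eq_zero_of_hasAdditiveReductionAt hv (hasAdditiveReductionAt_of_addv W p hW)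
      (dvd_pow_self p he.ne')]
    simp
  have ha : ‖cuspCoeff D.f p‖ ^ 2 < ((p : ℝ) + 1) ^ 2 := by
    have h := D.isNewformOf.norm_cuspCoeff_prime_pow_sq_le hpp 1
    rw [pow_one, pow_one] at h
    norm_num at h
    have hp1 : (1 : ℝ) < p := by exact_mod_cast hpp.one_lt
    nlinarith [h, hp1, sq_nonneg ((p : ℝ) - 1)]
  have hpN : p ∣ N := hN ▸ (dvd_pow_self p two_ne_zero).mul_right M
  have hA := petersson_ratio_of_coeff_twist_good D'.isNewformOf.1 D.isNewformOf.1 hpp hpN hpM hcoef hzero ha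
  -- `a² = (a_p(V))²`
  have ha2 : ‖cuspCoeff D.f p‖ ^ 2 = ((V.LFunction p : ℤ) : ℝ) ^ 2 := by
    rw [D.isNewformOf.2 p, Complex.norm_intCast, sq_abs]
  rw [ha2] at hA
  -- `ψ(N) = p(p+1) ψ(M)`
  have hψ : (gamma0Index N : ℝ) = p * (p + 1) * gamma0Index M := by
    have hcop : (p ^ 2).Coprime M :=
      (Nat.Coprime.pow_left 2 ((Nat.Prime.coprime_iff_not_dvd hpp).mpr hpM))
    rw [hN, gamma0Index_mul hcop, gamma0Index_prime_pow hpp two_ne_zero]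
    push_cast
    ring
  rw [hψ] at hA
  have hψM : (0 : ℝ) < gamma0Index M := by exact_mod_cast gamma0Index_pos M
  have hp0 : (0 : ℝ) < p := by exact_mod_cast hpp.pos
  -- `Re(f,f) · p = (p-1)((p+1)² - a²) · Re(g,g)`
  have hB : (peterssonProduct (Gamma0 N) 2 D'.f D'.f).re * p =
      ((p : ℝ) - 1) * (((p : ℝ) + 1) ^ 2 - ((V.LFunction p : ℤ) : ℝ) ^ 2) *
        (peterssonProduct (Gamma0 M) 2 D.f D.f).re := by
    have h1 : (p + 1) * (p : ℝ) * gamma0Index M ≠ 0 := by positivity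
    apply mul_right_cancel₀ h1
    linear_combination hA
  -- Zagier for both data (real parts) and the covolume relation
  have hZ := D.zagier_degree_formula_holds
  have hZ' := D'.zagier_degree_formula_holds
  unfold ModularParametrizationData.zagier_degree_formula at hZ hZ'
  have hre : ∀ {L : ℕ} [NeZero L] (h : CuspForm (Gamma0 L) 2),
      peterssonProduct (Gamma0 L) 2 h h = ((peterssonProduct (Gamma0 L) 2 h h).re : ℂ) := by
    intro L _ h
    have hc := peterssonProduct_conj_symm_holds (Gamma0 L) 2 h h
    have him : (peterssonProduct (Gamma0 L) 2 h h).im = 0 := by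
      simpa using Complex.conj_eq_iff_im.mp hc.symm
    exact Complex.ext (by simp) (by simp [him])
  rw [hre D.f] at hZ
  rw [hre D'.f] at hZ'
  have hZr : 4 * Real.pi ^ 2 * (D.c : ℝ) ^ 2 * (peterssonProduct (Gamma0 M) 2 D.f D.f).re =
      D.deg * ZLattice.covolume D.L.lattice := by exact_mod_cast hZ
  have hZr' : 4 * Real.pi ^ 2 * (D'.c : ℝ) ^ 2 * (peterssonProduct (Gamma0 N) 2 D'.f D'.f).re =
      D'.deg * ZLattice.covolume D'.L.lattice := by exact_mod_cast hZ'
  have habs : |(((-1 : ℚ) ^ (p / 2) * p : ℚ) : ℝ)| = p := by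
    push_cast
    rw [abs_mul, abs_pow, abs_neg, abs_one, one_pow, one_mul, Nat.abs_cast]
  have hcov := covolume_neronLattice_of_twist V W hd0 C hC D.isNeronLattice D'.isNeronLattice
  rw [habs] at hcov
  have hcovpos : 0 < ZLattice.covolume D.L.lattice := ZLattice.covolume_pos _ _
  have h4 : (4 * Real.pi ^ 2 * ZLattice.covolume D.L.lattice : ℝ) ≠ 0 := by positivity
  refine mul_left_cancel₀ h4 ?_
  -- goal · (4π² covol_V):  deg' u² c² (4π² cov) = K deg c'² (4π² cov)
  linear_combination (-(4 * Real.pi ^ 2 * (D'.deg : ℝ) * (D.c : ℝ) ^ 2)) * hcov +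
    (-(4 * Real.pi ^ 2 * (D.c : ℝ) ^ 2 * (p : ℝ))) * hZr' +
    ((4 * Real.pi ^ 2) ^ 2 * (D.c : ℝ) ^ 2 * (D'.c : ℝ) ^ 2) * hB +
    (4 * Real.pi ^ 2 * (((p : ℝ) - 1) * (((p : ℝ) + 1) ^ 2 - ((V.LFunction p : ℤ) : ℝ) ^ 2)) *
      (D'.c : ℝ) ^ 2) * hZr

end Summit.BirchSwinnertonDyer.Rank1Residual.Additive

end
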